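import Summits.QuantumFields.BalabanUV.Beta.GAN24.CombBornSector
import Summits.QuantumFields.BalabanUV.Beta.GAN24.WilsonSectorRow
import Summits.QuantumFields.BalabanUV.Beta.GAN24.BornBorderLineage

/-!
# The (III′) Wilson INSERTION DEFECT unrolled: `push₃ T′T′T′ X − push₃ TTT X` is ONE `(𝒯 − 1)`-insertion per level on the (E) partial pushes,
# read through that level's dressed legs and transported by the conjugated pushes above

NOT IN PRINT — OUR BOOKKEEPING (road-P2 = `b2b-balaban-gan24-p2` gen 56, 2026-08-25; row G-an2-4 ∕ (CONV-C), the (α-0) chain at row D1's literal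
OF RECORD (III′) `JsB12CombShSym`; [folklore] composition BY NAME; 0 `def`, 0 cite, 0 `def … : Prop`, 0 `sorry`).  Weight 0.  NEVER «G-an2-4 closed» as (CONV-C);
NOT D1, NOT BetaPertH, NOT continuum, NOT Clay; NO campaign opened (an2 W-4).

M.52 `CombWilsonSectorRow.exists_hS0_combWilson_of_contact_sub` and M.54 `CombWilsonSectorRate` reduce the (III′) Wilson half of the S-slot to the (E) contact ENDs at the
centred root plus a bound on the INSERTION DEFECT `push₃ T′_k T′_k T′_k W − push₃ T_k T_k T_k W` (`T_k = legChain R 0 k`, `T′_k = legChain (fun j ↦ legComp ψ♭ R_j) 0 k`,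
`R_j = respStepBmSeq ρ_c Lc j`, `ψ♭ α x κ u = Ψ̂ u x (inl κ) (inl α)`, `Ψ̂ = psiKS (ctrOff (d+1) Lc) Lc`, `𝒯 Y κ u = Ψ̂ᵀ ∘ slotPsiS Y κ u ∘ Ψ̂`).  This file says WHAT that defect is.
* §1 (generic; leaf-01's `AffineUnroll` engine) **`transport_sub_transport_eq_sum`** — two families of level maps `A′`, `A` preserving a class `P ∋ 0` closed under `+`, `−`,
  with `A′` additive on `P`: `transport A′ 0 n x − transport A 0 n x = Σ_{m<n} transport A′ (m+1) (n−1−m) (A′ m (P_m) − A m (P_m))`, `P_m = transport A 0 m x`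
  (`eq_transport_add_sum` on the difference sequence; `transport_map_zero`).
* §2 (generic `d`, any `Lc ≥ 1`, any ff-valued LOCAL table `X`) with `A j Y = push₃ R_j R_j R_j Y`, `A′ j Y = push₃ (legComp ψ♭ R_j)³ Y` on the class «ff-valued ∧ localised»:
  **`insertionDefect_eq_sum`** — `transport A′ 0 n X − transport A 0 n X = Σ_{m<n} transport A′ (m+1) (n−1−m) (push₃ R_m R_m R_m (𝒯 P_m − P_m))`: at each level `m` ONE
  `(𝒯 − 1)` acts on the (E) PARTIAL PUSH `P_m = transport A 0 m X` (= `push₃ (legChain R 0 (m−1))³ X` for `m ≥ 1`, leaf-01's `Push3Nest.transport_push₃`), is read through the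
  level-`m` dressed legs `R_m` (M.47 `push₃_transport_eq_push₃_legComp`: `push₃ (ψ♭R)³ Y = push₃ R³ (𝒯 Y)`; leaf-01's `push₃_sub`), and is transported by the CONJUGATED pushes
  of the levels `m+1, …, n−1`; **`push₃_legChain_sub_eq_sum`** — the same with both ends as ONE push through the chains `T′_{n}` ∕ `T_{n}` (`transport_push₃`).
* §3 **`insertionDefect_eq_zero_of_legDiv_zero`** — IF every (E) partial push `P_m`, `m < n`, is slot- and leg-divergence-free (the three letters of M.46
  `CombTransportThreeLegs.transport_eq_self_of_legDiv_zero`), THEN the insertion defect VANISHES.  So the NEW content of the (III′) Wilson contact END (M.52's `hΨ`,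
  M.54's `hCTd′` beyond the (E) ENDs) is EXACTLY the three DIVERGENCE LETTERS (slot, left leg, right leg) of the (E) partial Wilson pushes `push₃ (legChain R 0 m)³ (wilsonA d)`,
  block-summed into face terms (M.46: `𝒯 Y − Y = faceWt •` block sums of those divergences) and pushed through localised legs (leaf-01's `Push3.locStencil_push₃`) — (E)
  objects and the (E) LEG dictionary; nothing of the sym tables.  (A located reduction; weight 0; nobody asked — memo `gen55/S-CAMPAIGN-SIZING-g55.v0_3.md` §3(a).)
-/

noncomputable section

open Finset
open scoped BigOperators
open Literature.MathematicalPhysics.QuantumFieldTheory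
open Literature.MathematicalPhysics.QuantumFieldTheory.Balaban1983to89
open Literature.MathematicalPhysics.QuantumFieldTheory.Balaban1983to89.Beta
open ExpKernelCalculus (MKer comp)
open AffineAveraging (Site box toSite unitVec)
open AveragingContoursRooted (ctr ctrOff ctrOff_mem_box)
open OneStepResolventKernel (Fib LocStencil)
open Summit.QuantumFields.BalabanUV.Beta.TameKernelCalculus (trK)
open Summit.QuantumFields.BalabanUV.Beta.AxialDressingRooted (one_le_of_neZero)
open Summit.QuantumFields.BalabanUV.Beta.GAN24.Push4 (legComp IsFF)
open Summit.QuantumFields.BalabanUV.Beta.GAN24.Push4Bounds (LegDecay)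
open Summit.QuantumFields.BalabanUV.Beta.GAN24.Push4Iter (LegFam legChain)
open Summit.QuantumFields.BalabanUV.Beta.GAN24.Push3 (push₃ push₃_smul push₃_sub push₃_add isFF_push₃)
open Summit.QuantumFields.BalabanUV.Beta.GAN24.AffineUnroll (transport transport_zero transport_succ eq_transport_add_sum transport_mem transport_map_zero)
open Summit.QuantumFields.BalabanUV.Beta.GAN24.Push3Nest (transport_push₃)
open Summit.QuantumFields.BalabanUV.Beta.GAN24.RespStepBmDecompExact (respStepBmSeq)
open Summit.QuantumFields.BalabanUV.Beta.GAN24.SrecWilsonSector (isFF_smul legDecay_respStepBmSeq)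
open Summit.QuantumFields.BalabanUV.Beta.GAN24.SrecBornSector (isLoc_zero isLoc_add isLoc_smul isFF_transport_push)
open Summit.QuantumFields.BalabanUV.Beta.GAN24.WilsonSectorRow (isFF_sub)
open Summit.QuantumFields.BalabanUV.Beta.GAN24.BornBorderLineage (isFF_add)
open Summit.QuantumFields.BalabanUV.Beta.SymCorrectorKernel (psiKS)
open Summit.QuantumFields.BalabanUV.Beta.SymCorrectorFace (slotPsiS)
open Summit.QuantumFields.BalabanUV.Beta.GAN24.CombCubicStepTransport (locStencil_transportPsiS)
open Summit.QuantumFields.BalabanUV.Beta.GAN24.CombTransportThreeLegs (isFF_transport transport_eq_self_of_legDiv_zero)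
open Summit.QuantumFields.BalabanUV.Beta.GAN24.CombTransportPush (push₃_transport_eq_push₃_legComp)
open Summit.QuantumFields.BalabanUV.Beta.GAN24.CombBornSector (isLoc_push₃ legDecay_combLeg)

namespace Summit.QuantumFields.BalabanUV.Beta.GAN24.CombWilsonInsertionDefect

/-! ## §1 Two transports compared: the discrete Duhamel formula for the difference -/

section Generic

variable {E : Type*} [AddCommGroup E] {P : E → Prop} {A A' : ℕ → E → E}

/-- [folklore] **TWO COMPOSITE TRANSPORTS DIFFER BY THE TRANSPORTED ONE-LEVEL DEFECTS** (discrete Duhamel ∕ telescoping): for level maps `A′ j`, `A j` preserving a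
class `P ∋ 0` closed under `+` and `−`, with every `A′ j` additive on `P`, and `x ∈ P`:
`transport A′ 0 n x − transport A 0 n x = Σ_{m<n} transport A′ (m+1) (n−1−m) (A′ m (transport A 0 m x) − A m (transport A 0 m x))`
— the difference sequence obeys the affine recursion `D (m+1) = A′ m (D m) + (A′ m P_m − A m P_m)`, `D 0 = 0` (leaf-01's `AffineUnroll.eq_transport_add_sum`). -/
theorem transport_sub_transport_eq_sum (hP0 : P 0) (hPadd : ∀ x y, P x → P y → P (x + y)) (hPsub : ∀ x y, P x → P y → P (x - y))
    (hA'P : ∀ j x, P x → P (A' j x)) (hAP : ∀ j x, P x → P (A j x)) (hA'add : ∀ j x y, P x → P y → A' j (x + y) = A' j x + A' j y)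
    {x : E} (hx : P x) (n : ℕ) :
    transport A' 0 n x - transport A 0 n x
      = ∑ m ∈ Finset.range n, transport A' (m + 1) (n - 1 - m) (A' m (transport A 0 m x) - A m (transport A 0 m x)) := by
  have hPm : ∀ m, P (transport A 0 m x) := fun m => transport_mem hAP 0 m hx
  have hP'm : ∀ m, P (transport A' 0 m x) := fun m => transport_mem hA'P 0 m hx
  have hrec : ∀ j, transport A' 0 (j + 1) x - transport A 0 (j + 1) x
      = A' j (transport A' 0 j x - transport A 0 j x) + (A' j (transport A 0 j x) - A j (transport A 0 j x)) := by
    intro j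
    rw [transport_succ, transport_succ, Nat.zero_add]
    have e : transport A' 0 j x = (transport A' 0 j x - transport A 0 j x) + transport A 0 j x := (sub_add_cancel _ _).symm
    conv_lhs => rw [e]
    rw [hA'add j _ _ (hPsub _ _ (hP'm j) (hPm j)) (hPm j)]
    abel
  have h := eq_transport_add_sum (A := A') (P := P) hP0 hPadd hA'P hA'add
    (x := fun m => transport A' 0 m x - transport A 0 m x) (b := fun m => A' m (transport A 0 m x) - A m (transport A 0 m x))
    (by simp only [transport_zero, sub_self]; exact hP0) (fun j => hPsub _ _ (hA'P j _ (hPm j)) (hAP j _ (hPm j))) hrec n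
  simp only [transport_zero, sub_self] at h
  rw [transport_map_zero hP0 hA'add, zero_add] at h
  exact h

end Generic

/-! ## §2 The (III′) Wilson insertion defect -/

section Comb

variable {d : ℕ} {Lc : ℕ} [NeZero Lc]

omit [NeZero Lc] in
/-- [folklore] The class «ff-valued ∧ localised» is closed under subtraction. -/
theorem isFFLoc_sub {S S' : Fin (d + 1) → Site (d + 1) → MKer (d + 1) (Fib d)}
    (hS : (∀ κ u, IsFF (S κ u)) ∧ ∃ Cs δ : ℝ, 0 < δ ∧ LocStencil S Cs δ) (hS' : (∀ κ u, IsFF (S' κ u)) ∧ ∃ Cs δ : ℝ, 0 < δ ∧ LocStencil S' Cs δ) :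
    (∀ κ u, IsFF ((S - S') κ u)) ∧ ∃ Cs δ : ℝ, 0 < δ ∧ LocStencil (S - S') Cs δ := by
  refine ⟨fun κ u => by rw [Pi.sub_apply]; exact isFF_sub (hS.1 κ u) (hS'.1 κ u), ?_⟩
  have e : S - S' = S + fun κ u => (-1 : ℝ) • S' κ u := by funext κ u; simp only [Pi.sub_apply, Pi.add_apply, neg_one_smul, sub_eq_add_neg]
  rw [e]
  exact isLoc_add hS.2 (isLoc_smul hS'.2 _)

/-- [folklore] **ON AN ff-VALUED LOCAL TABLE THE ONE-LEVEL DEFECT IS THE DRESSED PUSH OF `𝒯 Y − Y`**: `push₃ (ψ♭R_j)³ Y − push₃ R_j³ Y = push₃ R_j R_j R_j (𝒯 Y − Y)`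
(M.47 `push₃_transport_eq_push₃_legComp` + leaf-01's `push₃_sub`; `𝒯 Y` is localised by M.43 `locStencil_transportPsiS`). -/
theorem stepDefect_eq_push₃_sub (j : ℕ) {Y : Fin (d + 1) → Site (d + 1) → MKer (d + 1) (Fib d)} (hff : ∀ κ u, IsFF (Y κ u))
    (hY : ∃ Cs δ : ℝ, 0 < δ ∧ LocStencil Y Cs δ) :
    push₃
        (legComp (fun α x κ u => psiKS (ctrOff (d + 1) Lc) Lc u x (Sum.inl κ) (Sum.inl α)) (respStepBmSeq (ctr (d + 1) Lc) Lc j))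
        (legComp (fun α x κ u => psiKS (ctrOff (d + 1) Lc) Lc u x (Sum.inl κ) (Sum.inl α)) (respStepBmSeq (ctr (d + 1) Lc) Lc j))
        (legComp (fun α x κ u => psiKS (ctrOff (d + 1) Lc) Lc u x (Sum.inl κ) (Sum.inl α)) (respStepBmSeq (ctr (d + 1) Lc) Lc j)) Y
      - push₃ (respStepBmSeq (ctr (d + 1) Lc) Lc j) (respStepBmSeq (ctr (d + 1) Lc) Lc j) (respStepBmSeq (ctr (d + 1) Lc) Lc j) Y
      = push₃ (respStepBmSeq (ctr (d + 1) Lc) Lc j) (respStepBmSeq (ctr (d + 1) Lc) Lc j) (respStepBmSeq (ctr (d + 1) Lc) Lc j)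
          (fun κ u => comp (comp (trK (psiKS (ctrOff (d + 1) Lc) Lc)) (slotPsiS (ctrOff (d + 1) Lc) Lc Y κ u)) (psiKS (ctrOff (d + 1) Lc) Lc) - Y κ u) := by
  have hLc : 0 < Lc := Nat.pos_of_ne_zero (NeZero.ne Lc)
  have hr : ctrOff (d + 1) Lc ∈ box (d + 1) Lc := ctrOff_mem_box hLc
  obtain ⟨C, δ, hδ, hYl⟩ := hY
  obtain ⟨CR, mR, hmR, hR'⟩ := legDecay_respStepBmSeq (Lc := Lc) hr j
  have hR : LegDecay (respStepBmSeq (ctr (d + 1) Lc) Lc j) Lc CR mR := hR'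
  obtain ⟨C₁, δ₁, hδ₁, h₁⟩ := locStencil_transportPsiS hLc hr hYl hδ
  funext κ' u'
  rw [Pi.sub_apply, Pi.sub_apply, push₃_sub hR hR hR hmR h₁ hYl hδ₁ hδ κ' u', push₃_transport_eq_push₃_legComp hLc hr hR hR hR hmR hff hYl hδ κ' u']

/-- NOT IN PRINT; OUR BOOKKEEPING ([folklore]).  **THE (III′) WILSON INSERTION DEFECT, UNROLLED** (generic `d`, any `Lc ≥ 1`, any ff-valued LOCAL table `X`): with the (E) pushes
`A j Y = push₃ R_j R_j R_j Y` and the conjugated pushes `A′ j Y = push₃ (legComp ψ♭ R_j)³ Y`,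
`transport A′ 0 n X − transport A 0 n X = Σ_{m<n} transport A′ (m+1) (n−1−m) (push₃ R_m R_m R_m (𝒯 P_m − P_m))`, `P_m = transport A 0 m X` — at each level `m` ONE `(𝒯 − 1)`
acts on the (E) PARTIAL PUSH `P_m`, is read through the level-`m` dressed legs, and is transported by the conjugated pushes above (§1 on the class «ff-valued ∧ localised»:
`isFF_push₃`, leaf-01's `BornBorderLineage.isFF_add`, M.51 `isLoc_push₃ ∕ legDecay_combLeg`, leaf-03's `legDecay_respStepBmSeq`, leaf-01's `push₃_add`; then `stepDefect_eq_push₃_sub` termwise). -/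
theorem insertionDefect_eq_sum {X : Fin (d + 1) → Site (d + 1) → MKer (d + 1) (Fib d)} (hff : ∀ κ u, IsFF (X κ u)) (hX : ∃ Cs δ : ℝ, 0 < δ ∧ LocStencil X Cs δ)
    (n : ℕ) :
    transport (fun j Y => push₃
        (legComp (fun α x κ u => psiKS (ctrOff (d + 1) Lc) Lc u x (Sum.inl κ) (Sum.inl α)) (respStepBmSeq (ctr (d + 1) Lc) Lc j))
        (legComp (fun α x κ u => psiKS (ctrOff (d + 1) Lc) Lc u x (Sum.inl κ) (Sum.inl α)) (respStepBmSeq (ctr (d + 1) Lc) Lc j))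
        (legComp (fun α x κ u => psiKS (ctrOff (d + 1) Lc) Lc u x (Sum.inl κ) (Sum.inl α)) (respStepBmSeq (ctr (d + 1) Lc) Lc j)) Y) 0 n X
      - transport (fun j Y => push₃ (respStepBmSeq (ctr (d + 1) Lc) Lc j) (respStepBmSeq (ctr (d + 1) Lc) Lc j) (respStepBmSeq (ctr (d + 1) Lc) Lc j) Y) 0 n X
      = ∑ m ∈ Finset.range n, transport (fun j Y => push₃
          (legComp (fun α x κ u => psiKS (ctrOff (d + 1) Lc) Lc u x (Sum.inl κ) (Sum.inl α)) (respStepBmSeq (ctr (d + 1) Lc) Lc j))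
          (legComp (fun α x κ u => psiKS (ctrOff (d + 1) Lc) Lc u x (Sum.inl κ) (Sum.inl α)) (respStepBmSeq (ctr (d + 1) Lc) Lc j))
          (legComp (fun α x κ u => psiKS (ctrOff (d + 1) Lc) Lc u x (Sum.inl κ) (Sum.inl α)) (respStepBmSeq (ctr (d + 1) Lc) Lc j)) Y) (m + 1) (n - 1 - m)
          (push₃ (respStepBmSeq (ctr (d + 1) Lc) Lc m) (respStepBmSeq (ctr (d + 1) Lc) Lc m) (respStepBmSeq (ctr (d + 1) Lc) Lc m)
            (fun κ u => comp (comp (trK (psiKS (ctrOff (d + 1) Lc) Lc))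
                (slotPsiS (ctrOff (d + 1) Lc) Lc (transport (fun j Y => push₃ (respStepBmSeq (ctr (d + 1) Lc) Lc j) (respStepBmSeq (ctr (d + 1) Lc) Lc j)
                  (respStepBmSeq (ctr (d + 1) Lc) Lc j) Y) 0 m X) κ u)) (psiKS (ctrOff (d + 1) Lc) Lc)
              - transport (fun j Y => push₃ (respStepBmSeq (ctr (d + 1) Lc) Lc j) (respStepBmSeq (ctr (d + 1) Lc) Lc j)
                  (respStepBmSeq (ctr (d + 1) Lc) Lc j) Y) 0 m X κ u)) := by
  have hLc : 0 < Lc := Nat.pos_of_ne_zero (NeZero.ne Lc)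
  have hr : ctrOff (d + 1) Lc ∈ box (d + 1) Lc := ctrOff_mem_box hLc
  -- the class «ff-valued ∧ localised»
  let P : (Fin (d + 1) → Site (d + 1) → MKer (d + 1) (Fib d)) → Prop := fun S => (∀ κ u, IsFF (S κ u)) ∧ ∃ Cs δ : ℝ, 0 < δ ∧ LocStencil S Cs δ
  have hP0 : P 0 := ⟨fun κ u => ⟨fun _ _ _ _ => rfl, fun _ _ _ _ => rfl⟩, isLoc_zero⟩
  have hPadd : ∀ S S', P S → P S' → P (S + S') :=
    fun S S' hS hS' => ⟨fun κ u => by rw [Pi.add_apply]; exact isFF_add (hS.1 κ u) (hS'.1 κ u), isLoc_add hS.2 hS'.2⟩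
  have hPsub : ∀ S S', P S → P S' → P (S - S') := fun S S' hS hS' => isFFLoc_sub hS hS'
  have hA'P : ∀ (j : ℕ) (S), P S → P (push₃
      (legComp (fun α x κ u => psiKS (ctrOff (d + 1) Lc) Lc u x (Sum.inl κ) (Sum.inl α)) (respStepBmSeq (ctr (d + 1) Lc) Lc j))
      (legComp (fun α x κ u => psiKS (ctrOff (d + 1) Lc) Lc u x (Sum.inl κ) (Sum.inl α)) (respStepBmSeq (ctr (d + 1) Lc) Lc j))
      (legComp (fun α x κ u => psiKS (ctrOff (d + 1) Lc) Lc u x (Sum.inl κ) (Sum.inl α)) (respStepBmSeq (ctr (d + 1) Lc) Lc j)) S) :=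
    fun j S hS => ⟨fun κ u => isFF_push₃ _ _ _ _ κ u, isLoc_push₃ (one_le_of_neZero Lc) (legDecay_combLeg (Lc := Lc) j) hS.2⟩
  have hAP : ∀ (j : ℕ) (S), P S →
      P (push₃ (respStepBmSeq (ctr (d + 1) Lc) Lc j) (respStepBmSeq (ctr (d + 1) Lc) Lc j) (respStepBmSeq (ctr (d + 1) Lc) Lc j) S) :=
    fun j S hS => ⟨fun κ u => isFF_push₃ _ _ _ _ κ u, isLoc_push₃ (one_le_of_neZero Lc) (legDecay_respStepBmSeq (Lc := Lc) hr j) hS.2⟩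
  have hA'add : ∀ (j : ℕ) (S S'), P S → P S' → push₃
      (legComp (fun α x κ u => psiKS (ctrOff (d + 1) Lc) Lc u x (Sum.inl κ) (Sum.inl α)) (respStepBmSeq (ctr (d + 1) Lc) Lc j))
      (legComp (fun α x κ u => psiKS (ctrOff (d + 1) Lc) Lc u x (Sum.inl κ) (Sum.inl α)) (respStepBmSeq (ctr (d + 1) Lc) Lc j))
      (legComp (fun α x κ u => psiKS (ctrOff (d + 1) Lc) Lc u x (Sum.inl κ) (Sum.inl α)) (respStepBmSeq (ctr (d + 1) Lc) Lc j)) (S + S')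
      = push₃
          (legComp (fun α x κ u => psiKS (ctrOff (d + 1) Lc) Lc u x (Sum.inl κ) (Sum.inl α)) (respStepBmSeq (ctr (d + 1) Lc) Lc j))
          (legComp (fun α x κ u => psiKS (ctrOff (d + 1) Lc) Lc u x (Sum.inl κ) (Sum.inl α)) (respStepBmSeq (ctr (d + 1) Lc) Lc j))
          (legComp (fun α x κ u => psiKS (ctrOff (d + 1) Lc) Lc u x (Sum.inl κ) (Sum.inl α)) (respStepBmSeq (ctr (d + 1) Lc) Lc j)) S
        + push₃
          (legComp (fun α x κ u => psiKS (ctrOff (d + 1) Lc) Lc u x (Sum.inl κ) (Sum.inl α)) (respStepBmSeq (ctr (d + 1) Lc) Lc j))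
          (legComp (fun α x κ u => psiKS (ctrOff (d + 1) Lc) Lc u x (Sum.inl κ) (Sum.inl α)) (respStepBmSeq (ctr (d + 1) Lc) Lc j))
          (legComp (fun α x κ u => psiKS (ctrOff (d + 1) Lc) Lc u x (Sum.inl κ) (Sum.inl α)) (respStepBmSeq (ctr (d + 1) Lc) Lc j)) S' := by
    intro j S S' hS hS'
    obtain ⟨C, δ, hδ, h⟩ := hS.2
    obtain ⟨C', δ', hδ', h'⟩ := hS'.2
    obtain ⟨Cl, m, hm, hl⟩ := legDecay_combLeg (d := d) (Lc := Lc) j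
    funext κ' u'
    exact push₃_add hl hl hl hm h h' hδ hδ' κ' u'
  rw [transport_sub_transport_eq_sum hP0 hPadd hPsub hA'P hAP hA'add ⟨hff, hX⟩ n]
  refine Finset.sum_congr rfl fun m _ => ?_
  have hPm := transport_mem (P := P) hAP 0 m ⟨hff, hX⟩
  rw [stepDefect_eq_push₃_sub (Lc := Lc) m hPm.1 hPm.2]

/-- NOT IN PRINT; OUR BOOKKEEPING ([folklore]).  **… WITH BOTH ENDS AS ONE PUSH THROUGH THE CHAINS** (`n = k+1`): `push₃ T′_k T′_k T′_k X − push₃ T_k T_k T_k X = Σ_{m ≤ k} …`,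
`T′_k = legChain (fun j ↦ legComp ψ♭ R_j) 0 k`, `T_k = legChain R 0 k` (leaf-01's `Push3Nest.transport_push₃` on both transports; the summands as in `insertionDefect_eq_sum`).
This is the object `hΨ` of M.52 `CombWilsonSectorRow.exists_hS0_combWilson_of_contact_sub` at `X = wilsonA 3`. -/
theorem push₃_legChain_sub_eq_sum {X : Fin (d + 1) → Site (d + 1) → MKer (d + 1) (Fib d)} (hff : ∀ κ u, IsFF (X κ u)) (hX : ∃ Cs δ : ℝ, 0 < δ ∧ LocStencil X Cs δ)
    (k : ℕ) :
    (fun κ' u' => push₃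
        (legChain (fun j => legComp (fun α x κ u => psiKS (ctrOff (d + 1) Lc) Lc u x (Sum.inl κ) (Sum.inl α)) (respStepBmSeq (ctr (d + 1) Lc) Lc j)) 0 k)
        (legChain (fun j => legComp (fun α x κ u => psiKS (ctrOff (d + 1) Lc) Lc u x (Sum.inl κ) (Sum.inl α)) (respStepBmSeq (ctr (d + 1) Lc) Lc j)) 0 k)
        (legChain (fun j => legComp (fun α x κ u => psiKS (ctrOff (d + 1) Lc) Lc u x (Sum.inl κ) (Sum.inl α)) (respStepBmSeq (ctr (d + 1) Lc) Lc j)) 0 k)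
        X κ' u'
      - push₃ (legChain (respStepBmSeq (ctr (d + 1) Lc) Lc) 0 k) (legChain (respStepBmSeq (ctr (d + 1) Lc) Lc) 0 k)
          (legChain (respStepBmSeq (ctr (d + 1) Lc) Lc) 0 k) X κ' u')
      = ∑ m ∈ Finset.range (k + 1), transport (fun j Y => push₃
          (legComp (fun α x κ u => psiKS (ctrOff (d + 1) Lc) Lc u x (Sum.inl κ) (Sum.inl α)) (respStepBmSeq (ctr (d + 1) Lc) Lc j))
          (legComp (fun α x κ u => psiKS (ctrOff (d + 1) Lc) Lc u x (Sum.inl κ) (Sum.inl α)) (respStepBmSeq (ctr (d + 1) Lc) Lc j))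
          (legComp (fun α x κ u => psiKS (ctrOff (d + 1) Lc) Lc u x (Sum.inl κ) (Sum.inl α)) (respStepBmSeq (ctr (d + 1) Lc) Lc j)) Y) (m + 1) (k - m)
          (push₃ (respStepBmSeq (ctr (d + 1) Lc) Lc m) (respStepBmSeq (ctr (d + 1) Lc) Lc m) (respStepBmSeq (ctr (d + 1) Lc) Lc m)
            (fun κ u => comp (comp (trK (psiKS (ctrOff (d + 1) Lc) Lc))
                (slotPsiS (ctrOff (d + 1) Lc) Lc (transport (fun j Y => push₃ (respStepBmSeq (ctr (d + 1) Lc) Lc j) (respStepBmSeq (ctr (d + 1) Lc) Lc j)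
                  (respStepBmSeq (ctr (d + 1) Lc) Lc j) Y) 0 m X) κ u)) (psiKS (ctrOff (d + 1) Lc) Lc)
              - transport (fun j Y => push₃ (respStepBmSeq (ctr (d + 1) Lc) Lc j) (respStepBmSeq (ctr (d + 1) Lc) Lc j)
                  (respStepBmSeq (ctr (d + 1) Lc) Lc j) Y) 0 m X κ u)) := by
  have hLc : 0 < Lc := Nat.pos_of_ne_zero (NeZero.ne Lc)
  have hr : ctrOff (d + 1) Lc ∈ box (d + 1) Lc := ctrOff_mem_box hLc
  have hT' := fun j => legDecay_combLeg (d := d) (Lc := Lc) j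
  have hT : ∀ j, ∃ C m : ℝ, 0 < m ∧ LegDecay (respStepBmSeq (ctr (d + 1) Lc) Lc j) Lc C m := fun j => legDecay_respStepBmSeq (Lc := Lc) hr j
  have h := insertionDefect_eq_sum (Lc := Lc) hff hX (k + 1)
  rw [transport_push₃ (one_le_of_neZero Lc) hT' hT' hT' hX 0 k, transport_push₃ (one_le_of_neZero Lc) hT hT hT hX 0 k] at h
  rw [show k + 1 - 1 = k from rfl] at h
  rw [← h]
  rfl

/-! ## §3 What would make the defect vanish: the three divergence letters of the (E) partial pushes -/

/-- NOT IN PRINT; OUR BOOKKEEPING ([folklore]; a located tightness statement).  **IF EVERY (E) PARTIAL PUSH IS SLOT- AND LEG-DIVERGENCE-FREE, THE (III′) INSERTION DEFECT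
VANISHES**: with `P_m = transport A 0 m X` (`= push₃ (legChain R 0 (m−1))³ X`, `m ≥ 1`; `P_0 = X`), if for every `m < n` the table `P_m` has zero slot divergence and zero
left ∕ right kernel-leg divergences (the three hypotheses of M.46 `CombTransportThreeLegs.transport_eq_self_of_legDiv_zero`, VERBATIM), then
`transport A′ 0 n X = transport A 0 n X`.  So the (III′) Wilson contact END's content beyond the (E) ENDs is EXACTLY these three DIVERGENCE LETTERS of (E) objects. -/
theorem insertionDefect_eq_zero_of_legDiv_zero {X : Fin (d + 1) → Site (d + 1) → MKer (d + 1) (Fib d)} (hff : ∀ κ u, IsFF (X κ u))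
    (hX : ∃ Cs δ : ℝ, 0 < δ ∧ LocStencil X Cs δ) (n : ℕ)
    (hslot : ∀ m, m < n → ∀ x : Site (d + 1), ∑ κ : Fin (d + 1),
      (transport (fun j Y => push₃ (respStepBmSeq (ctr (d + 1) Lc) Lc j) (respStepBmSeq (ctr (d + 1) Lc) Lc j) (respStepBmSeq (ctr (d + 1) Lc) Lc j) Y) 0 m X
          κ (x - unitVec κ)
        - transport (fun j Y => push₃ (respStepBmSeq (ctr (d + 1) Lc) Lc j) (respStepBmSeq (ctr (d + 1) Lc) Lc j) (respStepBmSeq (ctr (d + 1) Lc) Lc j) Y) 0 m X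
          κ x) = 0)
    (hleft : ∀ m, m < n → ∀ (κ : Fin (d + 1)) (u z : Site (d + 1)) (β : Fin (d + 1)) (x₀ : Site (d + 1)), ∑ α : Fin (d + 1),
      (transport (fun j Y => push₃ (respStepBmSeq (ctr (d + 1) Lc) Lc j) (respStepBmSeq (ctr (d + 1) Lc) Lc j) (respStepBmSeq (ctr (d + 1) Lc) Lc j) Y) 0 m X
          κ u (x₀ - unitVec α) z (Sum.inl α) (Sum.inl β)
        - transport (fun j Y => push₃ (respStepBmSeq (ctr (d + 1) Lc) Lc j) (respStepBmSeq (ctr (d + 1) Lc) Lc j) (respStepBmSeq (ctr (d + 1) Lc) Lc j) Y) 0 m X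
          κ u x₀ z (Sum.inl α) (Sum.inl β)) = 0)
    (hright : ∀ m, m < n → ∀ (κ : Fin (d + 1)) (u x : Site (d + 1)) (α : Fin (d + 1)) (z₀ : Site (d + 1)), ∑ β : Fin (d + 1),
      (transport (fun j Y => push₃ (respStepBmSeq (ctr (d + 1) Lc) Lc j) (respStepBmSeq (ctr (d + 1) Lc) Lc j) (respStepBmSeq (ctr (d + 1) Lc) Lc j) Y) 0 m X
          κ u x (z₀ - unitVec β) (Sum.inl α) (Sum.inl β)
        - transport (fun j Y => push₃ (respStepBmSeq (ctr (d + 1) Lc) Lc j) (respStepBmSeq (ctr (d + 1) Lc) Lc j) (respStepBmSeq (ctr (d + 1) Lc) Lc j) Y) 0 m X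
          κ u x z₀ (Sum.inl α) (Sum.inl β)) = 0) :
    transport (fun j Y => push₃
        (legComp (fun α x κ u => psiKS (ctrOff (d + 1) Lc) Lc u x (Sum.inl κ) (Sum.inl α)) (respStepBmSeq (ctr (d + 1) Lc) Lc j))
        (legComp (fun α x κ u => psiKS (ctrOff (d + 1) Lc) Lc u x (Sum.inl κ) (Sum.inl α)) (respStepBmSeq (ctr (d + 1) Lc) Lc j))
        (legComp (fun α x κ u => psiKS (ctrOff (d + 1) Lc) Lc u x (Sum.inl κ) (Sum.inl α)) (respStepBmSeq (ctr (d + 1) Lc) Lc j)) Y) 0 n X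
      = transport (fun j Y => push₃ (respStepBmSeq (ctr (d + 1) Lc) Lc j) (respStepBmSeq (ctr (d + 1) Lc) Lc j) (respStepBmSeq (ctr (d + 1) Lc) Lc j) Y) 0 n X := by
  have hLc : 0 < Lc := Nat.pos_of_ne_zero (NeZero.ne Lc)
  have hr : ctrOff (d + 1) Lc ∈ box (d + 1) Lc := ctrOff_mem_box hLc
  rw [← sub_eq_zero, insertionDefect_eq_sum (Lc := Lc) hff hX n]
  refine Finset.sum_eq_zero fun m hm => ?_
  have hm' : m < n := Finset.mem_range.1 hm
  have hffm : ∀ κ u, IsFF (transport (fun j Y => push₃ (respStepBmSeq (ctr (d + 1) Lc) Lc j) (respStepBmSeq (ctr (d + 1) Lc) Lc j)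
      (respStepBmSeq (ctr (d + 1) Lc) Lc j) Y) 0 m X κ u) := fun κ u => isFF_transport_push _ 0 hff m κ u
  have e0 : (fun κ u => comp (comp (trK (psiKS (ctrOff (d + 1) Lc) Lc))
        (slotPsiS (ctrOff (d + 1) Lc) Lc (transport (fun j Y => push₃ (respStepBmSeq (ctr (d + 1) Lc) Lc j) (respStepBmSeq (ctr (d + 1) Lc) Lc j)
          (respStepBmSeq (ctr (d + 1) Lc) Lc j) Y) 0 m X) κ u)) (psiKS (ctrOff (d + 1) Lc) Lc)
      - transport (fun j Y => push₃ (respStepBmSeq (ctr (d + 1) Lc) Lc j) (respStepBmSeq (ctr (d + 1) Lc) Lc j)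
          (respStepBmSeq (ctr (d + 1) Lc) Lc j) Y) 0 m X κ u) = fun κ u => (0 : ℝ) • (0 : MKer (d + 1) (Fib d)) := by
    funext κ u
    rw [transport_eq_self_of_legDiv_zero hLc hr hffm (hslot m hm') (hleft m hm') (hright m hm') κ u, sub_self, zero_smul]
  have e1 : transport (fun j Y => push₃
      (legComp (fun α x κ u => psiKS (ctrOff (d + 1) Lc) Lc u x (Sum.inl κ) (Sum.inl α)) (respStepBmSeq (ctr (d + 1) Lc) Lc j))
      (legComp (fun α x κ u => psiKS (ctrOff (d + 1) Lc) Lc u x (Sum.inl κ) (Sum.inl α)) (respStepBmSeq (ctr (d + 1) Lc) Lc j))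
      (legComp (fun α x κ u => psiKS (ctrOff (d + 1) Lc) Lc u x (Sum.inl κ) (Sum.inl α)) (respStepBmSeq (ctr (d + 1) Lc) Lc j)) Y) (m + 1) (n - 1 - m)
      (0 : Fin (d + 1) → Site (d + 1) → MKer (d + 1) (Fib d)) = 0 := by
    refine transport_map_zero (P := fun S : Fin (d + 1) → Site (d + 1) → MKer (d + 1) (Fib d) => ∃ Cs δ : ℝ, 0 < δ ∧ LocStencil S Cs δ) isLoc_zero
      (fun j S S' hS hS' => ?_) (m + 1) (n - 1 - m)
    obtain ⟨C, δ, hδ, h⟩ := hS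
    obtain ⟨C', δ', hδ', h'⟩ := hS'
    obtain ⟨Cl, mm, hmm, hl⟩ := legDecay_combLeg (d := d) (Lc := Lc) j
    funext κ' u'
    exact push₃_add hl hl hl hmm h h' hδ hδ' κ' u'
  have e2 : push₃ (respStepBmSeq (ctr (d + 1) Lc) Lc m) (respStepBmSeq (ctr (d + 1) Lc) Lc m) (respStepBmSeq (ctr (d + 1) Lc) Lc m)
      (fun κ u => (0 : ℝ) • (0 : MKer (d + 1) (Fib d))) = 0 := by
    funext κ' u'
    rw [push₃_smul, zero_smul]
    rfl
  rw [e0, e2, e1]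

end Comb

end Summit.QuantumFields.BalabanUV.Beta.GAN24.CombWilsonInsertionDefect

end
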